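import Summits.NavierStokesRegularity.NavierStokesRegularity.Theorems.RecurrentProfilesRecurrentReductionOrbit
import Literature.Analysis.FluidPDE.ScalingUniformRecurrence
import Literature.Analysis.FluidPDE.SelfSimilar
import HarnessLib

/-!
# Crux `ForcedSymmetry` (stmt-NavierStokesRegularity-4052), line `closing-dichotomy` (gen c9.1) —
# stub `stub_sensitivityNormalization`: the orbit-sensitivity constant may be measured on `Q(0,1)`

Theorems-only file (no definitions, no named facts).  Let `u : ℝ → ℝ³ → ℝ³` be ANY field and
`u_c = nsRescale c u`, `u_c(t,x) = c u(c² t, c x)`, its Navier–Stokes rescaling.  Suppose `u` is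
ORBIT-SENSITIVE at itself with constant `δ > 0` on SOME compact `K₁ ⊆ {t ≤ 0} × ℝ³`: every
`L³_loc`-neighbourhood `{‖· − u‖_{L³(K)} ≤ ε}` of `u` contains an orbit point `u_{e^σ}` and a
log-time `s` with `‖(u_{e^s})_{e^σ} − u_{e^s}‖_{L³(K₁)} > δ`.  Then the same holds with the
seminorm `L³(Q(0,1))` of the unit backward parabolic cylinder and some constant `δ' > 0`.

Proof (pure measure theory + the exact `L³` scaling law; no Navier–Stokes input).
1. `K₁ ⊆ Q(0, r) ∪ ({0} × ℝ³)` for `r = n + 1`, so `‖F‖_{L³(K₁)} ≤ ‖F‖_{L³(Q(0,r))}` for every `F`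
   (`exists_eLpNorm_restrict_le_of_isCompact`).
2. `‖v_r − w_r‖_{L³(Q(0,1))} = κ(r) ‖v − w‖_{L³(Q(0,r))}` with `κ(r) = r (r⁵)^{-1/3} ∈ (0, ∞)`
   (`eLpNorm_zoom_sub_zoom`, `nsRescale_eq_zoom`).
3. With `v = (u_{e^s})_{e^σ}`, `w = u_{e^s}`: `w_r = u_{e^{s + log r}}` and `v_r = (u_{e^{s + log r}})_{e^σ}`
   (`nsRescale_mul`, `nsRescale_comm`, `Real.exp_add`, `Real.exp_log`).
4. Take `δ' = κ(r) δ`; a separation `> δ` on `K₁` at log-time `s` becomes a separation `> δ'` on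
   `Q(0,1)` at log-time `s + log r`, for the SAME orbit point `u_{e^σ}`.

References: folklore (scaling bookkeeping of `L³_loc`; cf. D. Albritton, T. Barker,
J. Math. Fluid Mech. 21 (2019), §3 [AlbrittonBarker2019]).
-/

noncomputable section

-- the sub-problem namespace repeats the summit name (D-0017 layout `Summit.<S>.<P>.Theorems`)
set_option linter.dupNamespace false

namespace Summit.NavierStokesRegularity.NavierStokesRegularity.Theorems

open MeasureTheory Set Function Filter Topology TopologicalSpace Metric
open Literature.Analysis Literature.Analysis.FluidPDE
open scoped NNReal ENNReal

/-- Local notation for physical space `ℝ³ = EuclideanSpace ℝ (Fin 3)` (the registered stub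
signature is spelled with it). -/
local notation "ℝ³" => EuclideanSpace ℝ (Fin 3)

/-! ### Bookkeeping lemmas -/

/-- The scaling constant `c (c⁵)^{-1/3}` of `eLpNorm_zoom_sub_zoom` is nonzero for `c > 0`.
[folklore] -/
private theorem sensNorm_zoomConst_ne_zero {c : ℝ} (hc : 0 < c) :
    ‖c‖ₑ * (ENNReal.ofReal (c ^ 2 * c ^ 3)⁻¹) ^ (1 / (3 : ℝ≥0∞).toReal) ≠ 0 := by
  -- adapted from `frEpochRemoval_zoomConst_ne_zero` (RecurrentProfilesRecurrentLiouvilleFrEpochRemoval)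
  refine mul_ne_zero ?_ ?_
  · simpa using hc.ne'
  · exact (ENNReal.rpow_pos (ENNReal.ofReal_pos.2 (by positivity)) ENNReal.ofReal_ne_top).ne'

/-- **Scaling transport of an `L³` lower bound.**  If `‖F‖_{L³(K₁)} ≤ ‖F‖_{L³(Q(0,r))}` for all
`F` and `d < ‖v − w‖_{L³(K₁)}`, then `κ(r) d < ‖v_r − w_r‖_{L³(Q(0,1))}`, `κ(r) = r (r⁵)^{-1/3}`
(exact scaling law `eLpNorm_zoom_sub_zoom`). [folklore] -/
private theorem sensNorm_transport (v w : ℝ → ℝ³ → ℝ³) {r : ℝ} (hr : 0 < r)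
    {K₁ : Set (ℝ × ℝ³)}
    (hle : ∀ f : ℝ × ℝ³ → ℝ³, eLpNorm f 3 (volume.restrict K₁) ≤
      eLpNorm f 3 (volume.restrict (parabolicCylinder r (0 : ℝ × ℝ³))))
    {d : ℝ≥0∞} (hd : d < eLpNorm (fun z : ℝ × ℝ³ => v z.1 z.2 - w z.1 z.2) 3 (volume.restrict K₁)) :
    ‖r‖ₑ * (ENNReal.ofReal (r ^ 2 * r ^ 3)⁻¹) ^ (1 / (3 : ℝ≥0∞).toReal) * d <
      eLpNorm (fun z : ℝ × ℝ³ => nsRescale r v z.1 z.2 - nsRescale r w z.1 z.2) 3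
        (volume.restrict (parabolicCylinder 1 (0 : ℝ × ℝ³))) := by
  have key := eLpNorm_zoom_sub_zoom v w hr 1
  rw [mul_one, ← nsRescale_eq_zoom, ← nsRescale_eq_zoom] at key
  have e1 : uncurry (nsRescale r v) - uncurry (nsRescale r w) =
      fun z : ℝ × ℝ³ => nsRescale r v z.1 z.2 - nsRescale r w z.1 z.2 := rfl
  have e2 : uncurry v - uncurry w = fun z : ℝ × ℝ³ => v z.1 z.2 - w z.1 z.2 := rfl
  rw [e1, e2] at key
  rw [key]
  exact ENNReal.mul_lt_mul_right (sensNorm_zoomConst_ne_zero hr) (zoomConst_ne_top r)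
    (lt_of_lt_of_le hd (hle _))

/-- **Re-indexing the orbit along the zoom**: `(u_{e^s})_r = u_{e^{s + log r}}` for `r > 0`
(`nsRescale_mul`, `Real.exp_add`, `Real.exp_log`). [folklore] -/
private theorem sensNorm_nsRescale_exp_add_log (u : ℝ → ℝ³ → ℝ³) {r : ℝ} (hr : 0 < r) (s : ℝ) :
    nsRescale (Real.exp (s + Real.log r)) u = nsRescale r (nsRescale (Real.exp s) u) := by
  rw [Real.exp_add, Real.exp_log hr, nsRescale_mul]

/-! ### The registered stub -/

/-- **Stub `stub_sensitivityNormalization`** (registered stub of crux stmt-NavierStokesRegularity-4052,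
line `closing-dichotomy`, gen c9.1; known type): **the sensitivity constant may be measured on
`Q(0,1)`.**  If a field `u` is orbit-sensitive at itself with constant `δ` on SOME compact
`K₁ ⊆ {t ≤ 0} × ℝ³` (for every `ε > 0` and compact `K ⊆ {t ≤ 0} × ℝ³` there is an orbit point
`u_{e^σ}` within `ε` of `u` in `L³(K)` and a log-time `s` with
`‖(u_{e^s})_{e^σ} − u_{e^s}‖_{L³(K₁)} > δ`), then it is orbit-sensitive with some constant
`δ' > 0` on the unit backward cylinder `Q(0,1)`: `K₁ ⊆ Q(0,r) ∪ ({0} × ℝ³)` for `r = n + 1`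
(`exists_eLpNorm_restrict_le_of_isCompact`), and the exact scaling law
`‖v_r − w_r‖_{L³(Q(0,1))} = r (r⁵)^{-1/3} ‖v − w‖_{L³(Q(0,r))}` (`eLpNorm_zoom_sub_zoom`) moves a
separation `> δ` on `Q(0,r)` at log-time `s` to a separation `> δ' = r (r⁵)^{-1/3} δ` on `Q(0,1)`
at log-time `s + log r`.  No Navier–Stokes input; `u` is arbitrary. [folklore] -/
theorem stub_sensitivityNormalization :
    ∀ (u : ℝ → ℝ³ → ℝ³),
      (∃ δ : ℝ, 0 < δ ∧ ∃ K₁ : Set (ℝ × ℝ³), IsCompact K₁ ∧ K₁ ⊆ Set.Iic (0 : ℝ) ×ˢ Set.univ ∧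
        ∀ ε : ℝ, 0 < ε → ∀ K : Set (ℝ × ℝ³), IsCompact K → K ⊆ Set.Iic (0 : ℝ) ×ˢ Set.univ →
          ∃ σ : ℝ, eLpNorm (fun z : ℝ × ℝ³ => nsRescale (Real.exp σ) u z.1 z.2 - u z.1 z.2) 3
              (volume.restrict K) ≤ ENNReal.ofReal ε ∧
            ∃ s : ℝ, ENNReal.ofReal δ < eLpNorm (fun z : ℝ × ℝ³ =>
                nsRescale (Real.exp σ) (nsRescale (Real.exp s) u) z.1 z.2 - nsRescale (Real.exp s) u z.1 z.2) 3
              (volume.restrict K₁)) →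
      ∃ δ : ℝ, 0 < δ ∧
        ∀ ε : ℝ, 0 < ε → ∀ K : Set (ℝ × ℝ³), IsCompact K → K ⊆ Set.Iic (0 : ℝ) ×ˢ Set.univ →
          ∃ σ : ℝ, eLpNorm (fun z : ℝ × ℝ³ => nsRescale (Real.exp σ) u z.1 z.2 - u z.1 z.2) 3
              (volume.restrict K) ≤ ENNReal.ofReal ε ∧
            ∃ s : ℝ, ENNReal.ofReal δ < eLpNorm (fun z : ℝ × ℝ³ =>
                nsRescale (Real.exp σ) (nsRescale (Real.exp s) u) z.1 z.2 - nsRescale (Real.exp s) u z.1 z.2) 3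
              (volume.restrict (parabolicCylinder 1 (0 : ℝ × ℝ³))) := by
  intro u h
  obtain ⟨δ, hδ, K₁, hK₁, hK₁H, hP⟩ := h
  -- (1) `K₁ ⊆ Q(0, n+1)` up to a null set
  obtain ⟨n, hn⟩ := exists_eLpNorm_restrict_le_of_isCompact hK₁ hK₁H
  have hr : (0 : ℝ) < (n : ℝ) + 1 := by positivity
  -- (2) the scaling constant `κ = r (r⁵)^{-1/3}` and the new constant `δ' = κ δ`
  obtain ⟨κ, hκ⟩ : ∃ κ : ℝ≥0∞, κ = ‖(n : ℝ) + 1‖ₑ *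
      (ENNReal.ofReal (((n : ℝ) + 1) ^ 2 * ((n : ℝ) + 1) ^ 3)⁻¹) ^ (1 / (3 : ℝ≥0∞).toReal) :=
    ⟨_, rfl⟩
  have hκ0 : κ ≠ 0 := hκ ▸ sensNorm_zoomConst_ne_zero hr
  have hκT : κ ≠ ⊤ := hκ ▸ zoomConst_ne_top ((n : ℝ) + 1)
  have hδ0 : ENNReal.ofReal δ ≠ 0 := (ENNReal.ofReal_pos.2 hδ).ne'
  have hprodT : κ * ENNReal.ofReal δ ≠ ⊤ := ENNReal.mul_ne_top hκT ENNReal.ofReal_ne_top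
  have hprod0 : κ * ENNReal.ofReal δ ≠ 0 := mul_ne_zero hκ0 hδ0
  refine ⟨(κ * ENNReal.ofReal δ).toReal, ENNReal.toReal_pos hprod0 hprodT, ?_⟩
  intro ε hε K hK hKH
  obtain ⟨σ, hclose, s, hsep⟩ := hP ε hε K hK hKH
  refine ⟨σ, hclose, s + Real.log ((n : ℝ) + 1), ?_⟩
  -- (3) re-index the orbit: `u_{e^{s + log r}} = (u_{e^s})_r`, `((u_{e^s})_r)_{e^σ} = ((u_{e^s})_{e^σ})_r`
  rw [ENNReal.ofReal_toReal hprodT, sensNorm_nsRescale_exp_add_log u hr s, nsRescale_comm (Real.exp σ),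
    hκ]
  -- (4) transport the separation through the exact scaling law
  exact sensNorm_transport (nsRescale (Real.exp σ) (nsRescale (Real.exp s) u)) (nsRescale (Real.exp s) u)
    hr (fun f => hn f 3) hsep

end Summit.NavierStokesRegularity.NavierStokesRegularity.Theorems
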